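import Summits.HodgeConjecture.HodgeConjecture.Theses.BoundaryReadout
import Summits.HodgeConjecture.HodgeConjecture.Theses.LinearSystemTorelli
import Summits.HodgeConjecture.HodgeConjecture.Theorems.LinearSystemTorelliMiddleDivisorSupportFourfoldStubDominantEnvelope
import Summits.HodgeConjecture.HodgeConjecture.Theorems.LinearSystemTorelliMiddleDivisorSupportFourfoldStubFiniteMonodromyOfTypeStability
import Summits.HodgeConjecture.HodgeConjecture.Theorems.BoundaryReadoutAbsoluteReductionStubAbsoluteOfIso
import Summits.HodgeConjecture.HodgeConjecture.Theorems.QbarEnvelopeEnvelopeStubNumberFieldModel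
import Literature.AlgebraicGeometry.HodgeTheory.ContinuationLoopsZariskiOpen
import Literature.AlgebraicGeometry.HodgeTheory.AlgebraicCyclesDefinedOverQbarSpread
import Literature.AlgebraicGeometry.HodgeTheory.HodgeConjectureQbarVoisin
import Literature.AlgebraicGeometry.HodgeTheory.ComplexConjugationHolds
import Literature.AlgebraicGeometry.HodgeTheory.IsoTransport
import Literature.AlgebraicGeometry.FundamentalGroup.RiemannExistenceQbarDescentProofs
import Literature.Barriers.HodgeConjecture.ConjugateVarietiesProofs
import HarnessLib

/-!
# Route `BoundaryReadout` — crux `AbsoluteReduction` (stmt-HodgeConjecture-15945):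
# the crux modulo TYPE STABILITY OF ABSOLUTE CLASSES at `ℚ̄`-generic points (line `generic-flatness`)

Conditional file for the crux item stmt-HodgeConjecture-15945 (`--workitem`; it closes nothing by
itself). The registered line `Cruxes/AbsoluteReduction/Lines/generic_flatness.lean` reduces the crux
to six stubs S1, S2, C, D, N, P; S1 (`Theorems.stub_absoluteOfIso`, landed for this crux) and N
(`Theorems.stub_numberFieldModel`, landed for the sibling crux `Envelope`) are PROVED, so the line's
composition can now be landed in `Theorems/` with only its genuinely open inputs as hypotheses:

* **S2** (inline hypothesis `hT`, LOAD-BEARING, theorem in print: Charles–Schnell 2014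
  Thm. 11.3.15 (1) + Cor. 11.3.16; Voisin 2007 §2) — at a `ℚ̄`-generic point `s` of a smooth
  projective `ℚ̄`-family, the flat continuations of an ABSOLUTE Hodge class along loops avoiding a
  proper Zariski-closed subset of the base stay of type `(p,p)`;
* **C** as the Literature named fact `riemannExistence_qbarDescent_of_finiteIndex` (Riemann's
  existence theorem in covering form with `ℚ̄`-descent, SGA1 XII 5.1 + weak descent; its
  relative-dimension-`≥ 2` residual is the line's stub C);
* **D** as the route item `LinearSystemTorelli.DeligneGlobalInvariantCycles` (stmt-HodgeConjecture-16363,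
  `Iff.rfl` with the named fact `deligne_globalInvariantCycles`);
* **P** as the route item `BoundaryReadout.PullbackAlgebraic` (stmt-HodgeConjecture-1071).

Everything else is a tree theorem: Hodge models (`nonempty_hodgeModel_holds`), spreading out over
`ℚ̄` at a `ℚ̄`-generic point (`spreadingOut_smoothProjective_qbarFamily_holds`), loop shrinking
(`IsContinuationAlong.exists_loop_forall_base_pt_notMem_of_qbarFamily`), finiteness of the monodromy
orbit of a type-stable rational class
(`linearSystemTorelli_finite_setOf_isContinuationAlong_of_forall_isOfHodgeType`), Voisin's envelope
mechanism (`stub_dominantEnvelopeOfFiniteMonodromy`), number-field models, transitivity of base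
change (`Literature.Barriers.HodgeConjecture.nonempty_iso_baseChangeHom_baseChangeHom`).

## Main result

* `absoluteReduction_of_typeStableOfAbsolute` — S2 → C-fact → D-item → P-item → `AbsoluteReduction`
  (CONDITIONAL: the gate records a `conditional-result`; the item stays open).

## References

* C. Voisin, *Hodge loci and absolute Hodge classes*, Compositio Math. 143 (2007), Prop. 1.2, §2–§3.
  [Voisin2007HodgeLoci]
* F. Charles, C. Schnell, *Notes on absolute Hodge classes* (2014), Thm. 11.3.15, Cor. 11.3.16,
  Thm. 11.3.17, Thm. 11.3.19. [CharlesSchnell2014Notes]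
* P. Deligne, *Théorie de Hodge II*, Publ. Math. IHÉS 40 (1971), Thm. 4.1.1. [DeligneHodgeII1971]
* A. Grothendieck (ed.), SGA1, Exp. XII Thm. 5.1. [SGA1]
-/

-- every declaration of this problem lives in `Summit.HodgeConjecture.HodgeConjecture.…`
-- (single-problem summit: Problem = Summit), which `linter.dupNamespace` flags; set so that
-- stand-alone elaboration is warning-free.
set_option linter.dupNamespace false

noncomputable section

namespace Summit.HodgeConjecture.HodgeConjecture.Theorems

open CategoryTheory AlgebraicGeometry Topology
open Literature.AlgebraicGeometry Literature.AlgebraicGeometry.Motives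
open Literature.AlgebraicGeometry.HodgeTheory
open Literature.AlgebraicTopology.SingularHomology
open Summit.HodgeConjecture.HodgeConjecture.Theses

/-- **The crux modulo type stability of absolute classes (line `generic-flatness`, composed in
`Theorems/`).** Hypotheses: `hT` = stub S2 verbatim (type stability of the loop-continuations of an
absolute Hodge class at a `ℚ̄`-generic point, Zariski-locally on the base); `hC` = Riemann's
existence theorem with `ℚ̄`-descent (named fact); `hD` = Deligne's global invariant cycle theorem
(route item stmt-16363); `hP` = pull-back preserves algebraic classes (route item stmt-1071).
Proof (Voisin 2007 Prop. 1.2 along the `ℚ̄`-generic fibre): given `HCOverNumberFields`, `X` smooth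
projective and an absolute class `c`, fix `σ : ℚ̄ →+* ℂ` and spread `X` out, `e : X ≅ 𝒳_s` with
`s` `ℚ̄`-generic; `(e⁻¹)^* c` is absolute (S1, `Theorems.stub_absoluteOfIso`), hence type-stable
along all loops at `s` (`hT` + loop shrinking), hence of finite monodromy orbit; the envelope
mechanism fed with `hC`, `hD` writes it as `ι^* c'` with `c'` a rational `(p,p)` class on a smooth
projective `W₀ ⊗_σ ℂ`; `W₀` has a number-field model (N, `Theorems.stub_numberFieldModel`), so
`HCOverNumberFields` makes `c'` algebraic, and `hP` pulls algebraicity back along `ι` and `e.hom`.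
[cite: Voisin2007HodgeLoci, Prop. 1.2] [cite: CharlesSchnell2014Notes, Thm. 11.3.15 and Thm. 11.3.19] -/
theorem absoluteReduction_of_typeStableOfAbsolute
    (hT : ∀ (σ : AlgebraicClosure ℚ →+* ℂ) ⦃𝒳₀ S₀ : SchemeOver (AlgebraicClosure ℚ)⦄ (f₀ : 𝒳₀ ⟶ S₀)
      (n p : ℕ), IsQuasiProjectiveOver 𝒳₀ → IsQuasiProjectiveOver S₀ → IrreducibleSpace S₀.left →
      AlgebraicGeometry.Smooth S₀.hom → IsSmoothProjectiveFamily ((baseChangeHom σ).map f₀) n →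
      ∀ (s : ComplexPoints ((baseChangeHom σ).obj S₀)),
        closure {(baseChangeHomFst σ S₀).base s.pt} = (Set.univ : Set S₀.left) →
        ∀ (α : complexBetti (fiberOver ((baseChangeHom σ).map f₀) s) (2 * p)),
          IsAbsoluteHodgeClass n (fiberOver ((baseChangeHom σ).map f₀) s) p α →
          ∃ Z₀ : Set S₀.left, IsClosed Z₀ ∧ Z₀ ≠ Set.univ ∧
            ∀ (γ : Path s s), (∀ u, (baseChangeHomFst σ S₀).base (γ u).pt ∉ Z₀) →
              ∀ (β : complexBetti (fiberOver ((baseChangeHom σ).map f₀) s) (2 * p)),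
                IsContinuationAlong γ α β →
                  IsOfHodgeType n (fiberOver ((baseChangeHom σ).map f₀) s) (2 * p) p p β)
    (hC : Literature.AlgebraicGeometry.FundamentalGroup.riemannExistence_qbarDescent_of_finiteIndex)
    (hD : LinearSystemTorelli.DeligneGlobalInvariantCycles) (hP : BoundaryReadout.PullbackAlgebraic) :
    BoundaryReadout.AbsoluteReduction := by
  unfold BoundaryReadout.AbsoluteReduction
  intro hQ n X hX
  -- conjunct 1: a Hodge model exists (tree theorem); conjunct 2: absolute ⇒ algebraic
  refine ⟨nonempty_hodgeModel_holds hX, fun p c hc ↦ ?_⟩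
  -- an embedding `σ : ℚ̄ →+* ℂ`
  obtain ⟨σ⟩ := exists_ringHom_algebraicClosure_rat_complex
  -- spread `X` out over `ℚ̄`: `e : X ≅ 𝒳_s`, `s` over the generic point of the smooth irreducible `S₀`
  obtain ⟨𝒳₀, S₀, f₀, s, h𝒳₀, hS₀, hirr, hsm, hf, hgen, ⟨e⟩⟩ :=
    spreadingOut_smoothProjective_qbarFamily_holds σ hX
  have hXs : IsSmoothProjective n (fiberOver ((baseChangeHom σ).map f₀) s) := hf.isSmoothProjective s
  -- S1 (landed): the transported class `(e⁻¹)^* c` is absolute Hodge on the fibre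
  have habs : IsAbsoluteHodgeClass n (fiberOver ((baseChangeHom σ).map f₀) s) p
      (complexBetti.map e.inv (2 * p) c) := stub_absoluteOfIso e.symm hX hXs p c hc
  -- S2 + loop shrinking: type stability along every loop at `s`
  have hstab : ∀ (γ : Path s s) (β : complexBetti (fiberOver ((baseChangeHom σ).map f₀) s) (2 * p)),
      IsContinuationAlong γ (complexBetti.map e.inv (2 * p) c) β →
        IsOfHodgeType n (fiberOver ((baseChangeHom σ).map f₀) s) (2 * p) p p β := by
    intro γ β hγ
    obtain ⟨Z₀, hZ₀, hZ₀', H⟩ := hT σ f₀ n p h𝒳₀ hS₀ hirr hsm hf s hgen _ habs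
    haveI := hirr
    haveI := hsm
    obtain ⟨γ', hγ', hc'⟩ :=
      IsContinuationAlong.exists_loop_forall_base_pt_notMem_of_qbarFamily σ f₀ (2 * p) hS₀ hf hZ₀ hZ₀'
        hgen hγ
    exact H γ' hγ' β hc'
  -- finite monodromy orbit (Hodge–Riemann for the relative hyperplane class + lattice finiteness)
  have hfin := linearSystemTorelli_finite_setOf_isContinuationAlong_of_forall_isOfHodgeType σ
    f₀ n p hf h𝒳₀ hS₀ hirr hsm s (complexBetti.map e.inv (2 * p) c) habs.1 hstab
  -- Voisin's envelope mechanism, fed with C (Riemann existence) and D (partie fixe)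
  obtain ⟨m, W₀, ι, c', hW, -, hc', hh', hmap⟩ :=
    stub_dominantEnvelopeOfFiniteMonodromy hC hD σ f₀ n p h𝒳₀ hS₀ hirr hsm hf s hgen
      (complexBetti.map e.inv (2 * p) c) habs.1 habs.2.1 hfin
  -- `W₀` is smooth projective over `ℚ̄`, so it has a number-field model (N); HC over number fields
  obtain ⟨K, hK, hKn, ι₀, W₁, ⟨e₁⟩⟩ :=
    stub_numberFieldModel W₀ (isSmoothProjective_of_baseChangeHom σ W₀ hW)
  obtain ⟨e₂⟩ := Literature.Barriers.HodgeConjecture.nonempty_iso_baseChangeHom_baseChangeHom ι₀ σ W₁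
  have hHC : HodgeConjectureFor m ((baseChangeHom σ).obj W₀) :=
    hQ hW ⟨K, hK, hKn, σ.comp ι₀, W₁, ⟨(baseChangeHom σ).mapIso e₁ ≪≫ e₂⟩⟩
  have halg' : c' ∈ algebraicClasses ((baseChangeHom σ).obj W₀) p := hHC.2 p c' hc' hh'
  -- P: pull back along `ι`, then along `e.hom`
  have halg : complexBetti.map e.inv (2 * p) c ∈
      algebraicClasses (fiberOver ((baseChangeHom σ).map f₀) s) p := by
    rw [← hmap]
    exact hP hXs hW ι p c' halg'
  have key := hP hX hXs e.hom p _ halg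
  rwa [e.complexBetti_map_hom_map_inv] at key

end Summit.HodgeConjecture.HodgeConjecture.Theorems

end
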